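import Literature.AlgebraicGeometry.ModuliOfAbelianVarieties.SiegelCanonicalModel
import Literature.AlgebraicGeometry.ShimuraVarieties.UnitaryAuxiliaryReflexArtinNorm
import Literature.NumberTheory.ComplexMultiplication.ReflexNormIdelesTransitivity
import Literature.NumberTheory.ComplexMultiplication.CMTypeGaloisClassReflexDegree
import Literature.NumberTheory.AdelicBaseChange.AdeleNormTower
import HarnessLib

/-!
# The reciprocity law (62) of the Siegel canonical model descends along `E₀ ≤ E`: the `∀ E ⊇ ∏ E*(Φᵢ)` quantifier of
# `SiegelRationalModel.IsCanonical` is the law over the compositum of the reflex fields ([Deligne 1971] 3.13/4.21; [Milne ISV] (59)–(62))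

Topic `AlgebraicGeometry/ModuliOfAbelianVarieties`; namespace `Literature.AlgebraicGeometry.ModuliOfAbelianVarieties`.
THEOREMS ONLY (no definition, no named fact, no instance, no `sorry`; net Literature debt **0**).  Sequel of ★ (σ4)-D
`SiegelCanonicalModel` (`CMStructure.cmRecipMatrix`, `SiegelRationalModel.IsCanonical`).  Cell hodgecm-mathlib (D-0151),
banked GENERIC leaf #2 toward fan-B row I-7 (#60) `SiegelS1` (director g6 RULING s86 (2)(b); census memo
`CENSUS-60-SiegelS1.A-p05g7.md` §3, step M3 (iv) of the «Mumford line»): a STRENGTH READING of the fact's reciprocity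
clause — its universal quantifier over number fields `E ⊆ ℂ` containing every reflex field `E*(Φᵢ) = traceField (Φ i)`
is EQUIVALENT to the single instance `E = E₀(Φ) := ⨆ᵢ traceField (Φ i)` (the compositum of the reflex fields).

WHAT IS PROVED.
* §1 `finiteDimensional_traceField` — `E*(Φ) = ℚ(tr_Φ)` is finite over `ℚ` (public one-liner over ★
  `finrank_traceField_pos`; re-proved privately in four tree files so far).
* §2 `reflexNormFiniteIdele_eq_reflexNormFiniteIdele_finiteIdeleRelNorm_of_le` — [MilneCM2006] Prop. 1.23 (7) on finite
  idèles for a GENERAL tower `E* ≤ E₀ ≤ E ⊂ ℂ`: `N_{E,Φ}(s) = N_{E₀,Φ}(N_{E/E₀} s)` (the tree's ★ transitivity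
  `reflexNormFiniteIdele_eq_reflexNormFiniteIdele_traceField_finiteIdeleRelNorm` is the case `E₀ = E*`; the general tower
  is two instances of it and (19.13) ★ `finiteIdeleRelNorm_finiteIdeleRelNorm`).
* §3 `CMStructure.cmRecipMatrix_eq_cmRecipMatrix_finiteIdeleRelNorm` — the reciprocity elements agree:
  `r_E(s) = r_{E₀}(N_{E/E₀} s)` for `E₀ ≤ E` containing every `traceField (Φ i)`.
* §4 `SiegelRationalModel.reciprocity_of_le` — for a fixed CM special pair `(c, J, Φ)` of [Deligne1971TravauxShimura] 4.18
  and `E₀ ≤ E`: the law (62) over `E₀` («`σ • [J, a] = [J, r_{E₀}(s₀) · a]` for `σ ∈ Aut(ℂ/E₀)`, `art_{E₀}(s₀) = σ|`»)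
  IMPLIES the law over `E` — because `σ ∈ Aut(ℂ/E) ⊆ Aut(ℂ/E₀)`, `art_{E₀}(N_{E/E₀} s) = σ|` whenever `art_E(s) = σ|`
  (★ `IsArtinCorrespondent.finiteIdeleRelNorm`, [Shimura1998] §18.3 / [Milne2005ShimuraVarieties] (59)), and §3.  HEAD
  `SiegelRationalModel.isCanonical_iff_forall_iSup_traceField` — `R.IsCanonical ↔` the same clause stated ONLY at
  `E = ⨆ᵢ traceField (Φ i)`.
Nothing printed is asserted.  HC_CM is proved only modulo the 7 printed citations until rung 0 closes.

## References
* [Deligne1971TravauxShimura] P. Deligne, *Travaux de Shimura*, Sém. Bourbaki 389 (1971), Déf. 3.13 p. 141, 4.18 p. 150,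
  Thm. 4.21 p. 152.
* [Milne2005ShimuraVarieties] J. S. Milne, *Introduction to Shimura varieties* (2005), (59) p. 107, Def. 12.8 (60)–(62) p. 114.
* [MilneCM2006] J. S. Milne, *Complex Multiplication* (2006), Ch. I §1 Prop. 1.23 (7), Rem. 1.25.
* [Shimura1998] G. Shimura, *Abelian Varieties with Complex Multiplication and Modular Functions* (1998), §18.3
  pp. 121–122 («`[N_{k/L} y, L]` = restriction of `[y, k]`»), §8.3 Prop. 28.
* [CasselsFrohlichANT1967] Cassels–Fröhlich, Ch. II §19 (19.13); Ch. VII §4 Prop. 4.3.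
-/

set_option autoImplicit false

noncomputable section

open Matrix NumberField IsDedekindDomain
open scoped TensorProduct

namespace Literature.AlgebraicGeometry.ModuliOfAbelianVarieties

open Literature.AlgebraicGeometry.Motives (CMType)
open Literature.NumberTheory.ComplexMultiplication
  (traceField reflexNormFiniteIdele finrank_traceField_pos
    reflexNormFiniteIdele_eq_reflexNormFiniteIdele_traceField_finiteIdeleRelNorm)
open Literature.NumberTheory.AdelicBaseChange (finiteIdeleRelNorm finiteIdeleRelNorm_finiteIdeleRelNorm)
open Literature.AlgebraicGeometry.ShimuraVarieties (UnitaryCanonicalModel.IsArtinCorrespondent)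

/-! ### §1. The reflex field `E*(Φ) = ℚ(tr_Φ)` is a number field -/

/-- **`E*(Φ) = ℚ(tr_Φ(K))` is finite over `ℚ`** (it has positive finite rank, ★ `finrank_traceField_pos`).
[cite: Shimura1998, §8.3 Prop. 28] -/
theorem finiteDimensional_traceField {K : Type} [Field K] [NumberField K] (Φ : CMType K) :
    FiniteDimensional ℚ ↥(traceField Φ) :=
  Module.finite_of_finrank_pos (finrank_traceField_pos Φ)

/-- The compositum `⨆ᵢ E*(Φᵢ)` of finitely many reflex fields is finite over `ℚ`. [cite: Shimura1998, §8.3 Prop. 28] -/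
theorem finiteDimensional_iSup_traceField {ι : Type} [Finite ι] {K : ι → Type} [∀ i, Field (K i)]
    [∀ i, NumberField (K i)] (Φ : ∀ i, CMType (K i)) :
    FiniteDimensional ℚ ↥(⨆ i, traceField (Φ i) : IntermediateField ℚ ℂ) :=
  haveI := fun i => finiteDimensional_traceField (Φ i)
  IntermediateField.finiteDimensional_iSup_of_finite

/-! ### §2. [MilneCM] Prop. 1.23 (7) on finite idèles for a general tower `E* ≤ E₀ ≤ E` -/

/-- **`N_{E,Φ}(s) = N_{E₀,Φ}(N_{E/E₀} s)` on finite idèles, for number fields `E*(Φ) ≤ E₀ ≤ E ⊂ ℂ`** (the reflex norm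
of [MilneCM2006] Rem. 1.25 «on the finite idèles» is transitive in the top field: Prop. 1.23 (7) `N_{E,Φ} = N_{E*,Φ*}… ∘
Nm_{E/E*}` at `E` and at `E₀`, and (19.13) `N_{E*/…}`-transitivity of the idèle norm ★ `finiteIdeleRelNorm_finiteIdeleRelNorm`).
The `E₀`-algebra structure on `E` is the inclusion. [cite: MilneCM2006, Ch. I §1 Prop. 1.23 (7) and Rem. 1.25]
[cite: CasselsFrohlichANT1967, Ch. II §19 (19.13)] -/
theorem reflexNormFiniteIdele_eq_reflexNormFiniteIdele_finiteIdeleRelNorm_of_le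
    (K : Type) [Field K] [NumberField K] (Φ : CMType K) (E₀ E : IntermediateField ℚ ℂ)
    [NumberField ↥E₀] [NumberField ↥E] (hΦ : traceField Φ ≤ E₀) (hle : E₀ ≤ E)
    (s : (FiniteAdeleRing (𝓞 ↥E) ↥E)ˣ) :
    letI : Algebra ↥E₀ ↥E := (IntermediateField.inclusion hle).toRingHom.toAlgebra
    reflexNormFiniteIdele K Φ E s = reflexNormFiniteIdele K Φ E₀ (finiteIdeleRelNorm ↥E₀ ↥E s) := by
  letI : Algebra ↥E₀ ↥E := (IntermediateField.inclusion hle).toRingHom.toAlgebra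
  haveI : FiniteDimensional ℚ ↥(traceField Φ) := finiteDimensional_traceField Φ
  haveI : NumberField ↥(traceField Φ) := NumberField.mk
  letI : Algebra ↥(traceField Φ) ↥E₀ := (IntermediateField.inclusion hΦ).toRingHom.toAlgebra
  letI : Algebra ↥(traceField Φ) ↥E := (IntermediateField.inclusion (hΦ.trans hle)).toRingHom.toAlgebra
  haveI : IsScalarTower ↥(traceField Φ) ↥E₀ ↥E := IsScalarTower.of_algebraMap_eq fun _ => rfl
  haveI : IsScalarTower ↥(traceField Φ) ↥E ℂ := IsScalarTower.of_algebraMap_eq fun _ => rfl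
  haveI : IsScalarTower ↥(traceField Φ) ↥E₀ ℂ := IsScalarTower.of_algebraMap_eq fun _ => rfl
  rw [reflexNormFiniteIdele_eq_reflexNormFiniteIdele_traceField_finiteIdeleRelNorm K Φ E s,
    reflexNormFiniteIdele_eq_reflexNormFiniteIdele_traceField_finiteIdeleRelNorm K Φ E₀,
    finiteIdeleRelNorm_finiteIdeleRelNorm]

/-! ### §3. The reciprocity elements over `E₀ ≤ E` agree: `r_E(s) = r_{E₀}(N_{E/E₀} s)` -/

namespace CMStructure

variable {g : ℕ} {δ : Fin g → ℕ} {ι : Type} [Fintype ι] [DecidableEq ι] {K : ι → Type} [∀ i, Field (K i)]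
  [∀ i, NumberField (K i)] [∀ i, IsCMField (K i)] (c : CMStructure g δ ι K)

/-- **The reciprocity element of a special pair over `E` is the reciprocity element over `E₀ ≤ E` at the norm**:
`c.cmRecipMatrix Φ E s = c.cmRecipMatrix Φ E₀ (N_{E/E₀} s)` whenever `E₀` contains every reflex field `E*(Φᵢ)`
(componentwise §2). [cite: MilneCM2006, Ch. I §1 Prop. 1.23 (7), Rem. 1.25] [cite: Milne2005ShimuraVarieties, Def. 12.8 (60)–(61) p. 114] -/
theorem cmRecipMatrix_eq_cmRecipMatrix_finiteIdeleRelNorm (Φ : ∀ i, CMType (K i)) (E₀ E : IntermediateField ℚ ℂ)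
    [NumberField ↥E₀] [NumberField ↥E] (hE₀ : ∀ i, traceField (Φ i) ≤ E₀) (hle : E₀ ≤ E)
    (s : (FiniteAdeleRing (𝓞 ↥E) ↥E)ˣ) :
    letI : Algebra ↥E₀ ↥E := (IntermediateField.inclusion hle).toRingHom.toAlgebra
    c.cmRecipMatrix Φ E s = c.cmRecipMatrix Φ E₀ (finiteIdeleRelNorm ↥E₀ ↥E s) := by
  unfold cmRecipMatrix
  congr 1
  funext i
  rw [reflexNormFiniteIdele_eq_reflexNormFiniteIdele_finiteIdeleRelNorm_of_le (K i) (Φ i) E₀ E (hE₀ i) hle s]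

end CMStructure

/-! ### §4. (62) over `E₀` implies (62) over every `E ⊇ E₀`; `IsCanonical` ⇔ (62) over the compositum of the reflex fields -/

namespace SiegelRationalModel

variable {g : ℕ} {δ : Fin g → ℕ} {Sg : SiegelComplexRecordSystem g δ} (R : SiegelRationalModel g δ Sg)
variable {ι : Type} [Fintype ι] [DecidableEq ι] {K : ι → Type} [∀ i, Field (K i)] [∀ i, NumberField (K i)]
  [∀ i, IsCMField (K i)]

/-- **THE RECIPROCITY LAW (62) DESCENDS ALONG `E₀ ≤ E`.**  Fix a CM structure `c` of type `δ`, `J ∈ S^±` and CM types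
`Φ` ([Deligne1971TravauxShimura] 4.18), and number fields `E₀ ≤ E ⊂ ℂ` with every `E*(Φᵢ) ≤ E₀`.  If the `ℚ`-model `R`
satisfies (62) for the pair over `E₀` — `σ • [J, a] = [J, r·a]` on the `ℚ`-structure points for all `σ ∈ Aut(ℂ/E₀)`, all
`E₀`-idèles `s₀` with `art_{E₀}(s₀) = σ|` and all `r ∈ GSp_δ(𝔸_f)` with matrix `r_{E₀}(s₀)` — then it satisfies (62)
for the pair over `E`: an `Aut(ℂ/E)` is an `Aut(ℂ/E₀)`, `art_E(s) = σ| ⇒ art_{E₀}(N_{E/E₀} s) = σ|`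
(★ `IsArtinCorrespondent.finiteIdeleRelNorm`; [Shimura1998] §18.3, [Milne2005ShimuraVarieties] (59)), and
`r_E(s) = r_{E₀}(N_{E/E₀} s)` (§3).  Texts = the body of ★ `SiegelRationalModel.IsCanonical` at `E₀` and at `E`.
[cite: Deligne1971TravauxShimura, Déf. 3.13 p. 141 and Thm. 4.21 p. 152] [cite: Milne2005ShimuraVarieties, (59) p. 107 and Def. 12.8 (62) p. 114]
[cite: Shimura1998, §18.3 pp. 121–122] -/
theorem reciprocity_of_le (c : CMStructure g δ ι K) (J : C0pm δ) (Φ : ∀ i, CMType (K i))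
    (E₀ E : IntermediateField ℚ ℂ) [NumberField ↥E₀] [NumberField ↥E] (hE₀ : ∀ i, traceField (Φ i) ≤ E₀)
    (hle : E₀ ≤ E)
    (h : ∀ (σ : ℂ ≃ₐ[↥E₀] ℂ) (s : (FiniteAdeleRing (𝓞 ↥E₀) ↥E₀)ˣ),
      UnitaryCanonicalModel.IsArtinCorrespondent ↥E₀ (algebraMap ↥E₀ ℂ) s σ.toRingEquiv →
      ∀ r : gspFinAdelic δ,
        ((r : GL (Fin g ⊕ Fin g) (FiniteAdeleRing (𝓞 ℚ) ℚ)) :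
            Matrix (Fin g ⊕ Fin g) (Fin g ⊕ Fin g) (FiniteAdeleRing (𝓞 ℚ) ℚ)) = c.cmRecipMatrix Φ E₀ s →
        ∀ (L : SiegelLevel δ) (a : gspFinAdelic δ),
          (σ.restrictScalars ℚ) • R.ptQ L ((Sg.pts L).symm (SiegelShimuraSet.mk δ L.1 J a)) =
            R.ptQ L ((Sg.pts L).symm (SiegelShimuraSet.mk δ L.1 J (r * a)))) :
    ∀ (σ : ℂ ≃ₐ[↥E] ℂ) (s : (FiniteAdeleRing (𝓞 ↥E) ↥E)ˣ),
      UnitaryCanonicalModel.IsArtinCorrespondent ↥E (algebraMap ↥E ℂ) s σ.toRingEquiv →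
      ∀ r : gspFinAdelic δ,
        ((r : GL (Fin g ⊕ Fin g) (FiniteAdeleRing (𝓞 ℚ) ℚ)) :
            Matrix (Fin g ⊕ Fin g) (Fin g ⊕ Fin g) (FiniteAdeleRing (𝓞 ℚ) ℚ)) = c.cmRecipMatrix Φ E s →
        ∀ (L : SiegelLevel δ) (a : gspFinAdelic δ),
          (σ.restrictScalars ℚ) • R.ptQ L ((Sg.pts L).symm (SiegelShimuraSet.mk δ L.1 J a)) =
            R.ptQ L ((Sg.pts L).symm (SiegelShimuraSet.mk δ L.1 J (r * a))) := by
  intro σ s hs r hr L a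
  letI : Algebra ↥E₀ ↥E := (IntermediateField.inclusion hle).toRingHom.toAlgebra
  -- `σ` as an `E₀`-algebra automorphism of `ℂ`
  let σ₀ : ℂ ≃ₐ[↥E₀] ℂ :=
    { σ.toRingEquiv with
      commutes' := fun y => σ.commutes (IntermediateField.inclusion hle y) }
  have hσ₀ : σ₀.toRingEquiv = σ.toRingEquiv := rfl
  have hσ₀' : σ₀.restrictScalars ℚ = σ.restrictScalars ℚ := AlgEquiv.ext fun _ => rfl
  -- the norm idèle is an Artin correspondent of the same `σ` over `E₀`
  have hs₀ : UnitaryCanonicalModel.IsArtinCorrespondent ↥E₀ (algebraMap ↥E₀ ℂ) (finiteIdeleRelNorm ↥E₀ ↥E s)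
      σ₀.toRingEquiv := by
    rw [hσ₀]
    exact UnitaryCanonicalModel.IsArtinCorrespondent.finiteIdeleRelNorm (fun _ => rfl) hs
  have hr₀ : ((r : GL (Fin g ⊕ Fin g) (FiniteAdeleRing (𝓞 ℚ) ℚ)) :
      Matrix (Fin g ⊕ Fin g) (Fin g ⊕ Fin g) (FiniteAdeleRing (𝓞 ℚ) ℚ)) =
        c.cmRecipMatrix Φ E₀ (finiteIdeleRelNorm ↥E₀ ↥E s) := by
    rw [hr]
    exact c.cmRecipMatrix_eq_cmRecipMatrix_finiteIdeleRelNorm Φ E₀ E hE₀ hle s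
  rw [← hσ₀']
  exact h σ₀ _ hs₀ r hr₀ L a

/-- **HEAD — `IsCanonical` ⇔ (62) over the compositum of the reflex fields.**  The reciprocity clause of ★
`SiegelRationalModel.IsCanonical` quantifies over ALL number fields `E ⊆ ℂ` containing every `E*(Φᵢ)`; it is
EQUIVALENT to the same clause at the single field `E₀(Φ) = ⨆ᵢ traceField (Φ i)` (the compositum `∏ E*(Φᵢ)` of
[Deligne1971TravauxShimura] Déf. 3.13 «défini sur `E · E(H, h′)`»): `⇒` is specialisation (`E*(Φᵢ) ≤ E₀(Φ)`), `⇐` is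
`reciprocity_of_le`.  So the `∀ E` of the typed fact #60 is not stronger than print's law over `E(G,h) · E(T, μ)`.
[cite: Deligne1971TravauxShimura, Déf. 3.13 p. 141 and Thm. 4.21 p. 152] [cite: Milne2005ShimuraVarieties, Def. 12.8 (62) p. 114; (59) p. 107] -/
theorem isCanonical_iff_forall_iSup_traceField :
    R.IsCanonical ↔
      ∀ (ι : Type) [Fintype ι] [DecidableEq ι] (K : ι → Type) [∀ i, Field (K i)] [∀ i, NumberField (K i)]
        [∀ i, IsCMField (K i)] (c : CMStructure g δ ι K) (J : C0pm δ) (Φ : ∀ i, CMType (K i)), c.IsSpecial J Φ →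
        haveI : FiniteDimensional ℚ ↥(⨆ i, traceField (Φ i) : IntermediateField ℚ ℂ) :=
          finiteDimensional_iSup_traceField Φ
        haveI : NumberField ↥(⨆ i, traceField (Φ i) : IntermediateField ℚ ℂ) := NumberField.mk
        ∀ (σ : ℂ ≃ₐ[↥(⨆ i, traceField (Φ i) : IntermediateField ℚ ℂ)] ℂ)
          (s : (FiniteAdeleRing (𝓞 ↥(⨆ i, traceField (Φ i) : IntermediateField ℚ ℂ))
            ↥(⨆ i, traceField (Φ i) : IntermediateField ℚ ℂ))ˣ),
          UnitaryCanonicalModel.IsArtinCorrespondent ↥(⨆ i, traceField (Φ i) : IntermediateField ℚ ℂ)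
              (algebraMap _ ℂ) s σ.toRingEquiv →
          ∀ r : gspFinAdelic δ,
            ((r : GL (Fin g ⊕ Fin g) (FiniteAdeleRing (𝓞 ℚ) ℚ)) :
                Matrix (Fin g ⊕ Fin g) (Fin g ⊕ Fin g) (FiniteAdeleRing (𝓞 ℚ) ℚ)) =
                  c.cmRecipMatrix Φ (⨆ i, traceField (Φ i)) s →
            ∀ (L : SiegelLevel δ) (a : gspFinAdelic δ),
              (σ.restrictScalars ℚ) • R.ptQ L ((Sg.pts L).symm (SiegelShimuraSet.mk δ L.1 J a)) =
                R.ptQ L ((Sg.pts L).symm (SiegelShimuraSet.mk δ L.1 J (r * a))) := by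
  constructor
  · intro h ι _ _ K _ _ _ c J Φ hsp
    haveI : FiniteDimensional ℚ ↥(⨆ i, traceField (Φ i) : IntermediateField ℚ ℂ) :=
      finiteDimensional_iSup_traceField Φ
    exact h ι K c J Φ hsp (⨆ i, traceField (Φ i)) (fun i => le_iSup (fun i => traceField (Φ i)) i)
  · intro h ι _ _ K _ _ _ c J Φ hsp E _ hE
    haveI : FiniteDimensional ℚ ↥(⨆ i, traceField (Φ i) : IntermediateField ℚ ℂ) :=
      finiteDimensional_iSup_traceField Φ
    haveI : NumberField ↥(⨆ i, traceField (Φ i) : IntermediateField ℚ ℂ) := NumberField.mk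
    haveI : NumberField ↥E := NumberField.mk
    exact R.reciprocity_of_le c J Φ (⨆ i, traceField (Φ i)) E (fun i => le_iSup (fun i => traceField (Φ i)) i)
      (iSup_le hE) (h ι K c J Φ hsp)

end SiegelRationalModel

end Literature.AlgebraicGeometry.ModuliOfAbelianVarieties

end
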